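/-
Copyright (c) 2026. All rights reserved.
Released under Apache 2.0 license as described in the file LICENSE.
Authors: abc-iut cell, seat abc-iut-w6-d109 (gen 2).
-/
import Mathlib.GroupTheory.Nilpotent
import Mathlib.Algebra.Group.Pointwise.Set.ListOfFn

/-!
# Twisted commutator width modulo a lower power-central series

Serre's successive-approximation argument (J. D. Dixon, M. du Sautoy, A. Mann, D. Segal,
*Analytic pro-`p` groups*, 2nd ed., proof of Prop. 1.19 / Thm 1.17) run RELATIVE to a normal subgroup
`Q ⊴ G` acted on by a subgroup `U ≤ G`, with three kinds of "slots".  Fix lists `l = [g₁,…,g_r]`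
(generating `U`) and `m = [x₁,…,x_s]` of elements of `Q` whose `U`-conjugates generate `Q`, and an
exponent `q`.  For a set `K` write `T(l, K) := {⁅g₁,y₁⁆ ⋯ ⁅g_r,y_r⁆ | yᵢ ∈ K}` (in Lean the pointwise
product of the list of sets `(fun y ↦ ⁅gᵢ, y⁆) '' K`; no definition is introduced) and
`W := T(l, Q) · T(m, Q) · {y ^ q | y ∈ Q}`.  Let `Q = D₀ ⊇ D₁ ⊇ D₂ ⊇ ⋯` be the LOWER `q`-CENTRAL
SERIES of `Q` inside `G`, `D_{j+1} = ⁅D_j, Q⁆ · ⟨D_j ^ q⟩` (taken as a hypothesis on a sequence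
`D : ℕ → Subgroup G`; again no definition).  Main results:

* `commutator_sup_powClosure_subset_wordSet_mul` — for every `j`, the ABSTRACT subgroup
  `A := ⁅Q, U⁆ ⊔ ⟨{y ^ q | y ∈ Q}⟩` satisfies `A ⊆ W · D_{j+1}`;
* `commutator_sup_powClosure_eq_wordSet` — hence if `D_c = ⊥` for some `c` (e.g. `Q` a finite
  `p`-group and `p ∣ q`, file `LowerPowerCentralSeriesFinite.lean`) and `l ⊆ U ⊇ Q`, then `A = W`:
  every element of `A` is a product of `r + s` commutators WITH THE FIXED ENTRIES `gᵢ`, `xₖ` and ONE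
  `q`-th power (twisted commutator width `r + s + 1`).

Mechanism of the step `W·D_{j+1} ⊆ W·D_{j+2}` (everything modulo `D_{j+2}`, where `D_{j+1}` is central
in `Q`): the `gᵢ`-slots absorb `⁅U, D_{j+1}⁆` through the identity `⁅γg, y⁆ = ⁅γ, gyg⁻¹⁆⁅g, y⁆`
(induction over words in the `gᵢ`), the `xₖ`-slots absorb `⁅Q, D_j⁆` through
`⁅uxu⁻¹, b⁆ = ⁅u, t⁆ · t`, `t = ⁅x, u⁻¹bu⁆` (induction over words in the conjugates `uxₖu⁻¹`), and the
power slot absorbs `D_j ^ q` since `(yc)^q ≡ y^q c^q (mod ⁅D_j, Q⁆)`.  Purely algebraic; the profinite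
consequences (closedness of `⁅P′, U⁆·P′^q` for pro-`p` `P′`, strong completeness) are drawn in
`Literature/GroupTheory/TwistedCommutatorWidthProfinite.lean`.

[cite: DDMSAnalyticProP1999, Prop 1.19 (proof), Thm 1.17]
-/

namespace Literature.GroupTheory

open scoped Pointwise commutatorElement

variable {G : Type*} [Group G]

/-! ### Commutator identities -/

/-- `⁅a, x·k⁆ = ⁅a, x⁆ · x⁅a, k⁆x⁻¹`. [cite: DDMSAnalyticProP1999, §0.1] -/
theorem commutatorElement_mul_right_eq (a x k : G) :
    ⁅a, x * k⁆ = ⁅a, x⁆ * (x * ⁅a, k⁆ * x⁻¹) := by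
  simp only [commutatorElement_def]; group

/-- `⁅u·u', y⁆ = ⁅u, u'yu'⁻¹⁆ · ⁅u', y⁆`. [cite: DDMSAnalyticProP1999, §0.1] -/
theorem commutatorElement_mul_left_eq (u u' y : G) :
    ⁅u * u', y⁆ = ⁅u, u' * y * u'⁻¹⁆ * ⁅u', y⁆ := by
  simp only [commutatorElement_def]; group

/-- `⁅u⁻¹, y⁆ = y · ⁅u, u⁻¹y⁻¹u⁆ · y⁻¹`. [cite: DDMSAnalyticProP1999, §0.1] -/
theorem commutatorElement_inv_left_eq (u y : G) :
    ⁅u⁻¹, y⁆ = y * ⁅u, u⁻¹ * y⁻¹ * u⁆ * y⁻¹ := by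
  simp only [commutatorElement_def]; group

/-- `⁅uau⁻¹, b⁆ = ⁅u, t⁆ · t` with `t = ⁅a, u⁻¹bu⁆`. [cite: DDMSAnalyticProP1999, §0.1] -/
theorem commutatorElement_conj_left_eq (u a b : G) :
    ⁅u * a * u⁻¹, b⁆ = ⁅u, ⁅a, u⁻¹ * b * u⁆⁆ * ⁅a, u⁻¹ * b * u⁆ := by
  simp only [commutatorElement_def]; group

/-! ### The word sets `T(l, K) = {⁅a₁,y₁⁆ ⋯ ⁅a_d,y_d⁆ | yᵢ ∈ K}` -/

/-- `1 ∈ T(l, K)` for a subgroup `K` (all `yᵢ = 1`). [cite: DDMSAnalyticProP1999, Prop 1.19 (proof)] -/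
theorem one_mem_wordSet (l : List G) (K : Subgroup G) :
    (1 : G) ∈ (l.map fun a => (fun y : G => ⁅a, y⁆) '' (K : Set G)).prod := by
  induction l with
  | nil => simp
  | cons a l ih =>
    rw [List.map_cons, List.prod_cons]
    exact Set.mem_mul.mpr ⟨1, ⟨1, K.one_mem, commutatorElement_one_right a⟩, 1, ih, one_mul 1⟩

/-- For `a` an entry of `l` and `y ∈ K`, `⁅a, y⁆ ∈ T(l, K)`.
[cite: DDMSAnalyticProP1999, Prop 1.19 (proof)] -/
theorem comm_mem_wordSet (K : Subgroup G) {l : List G} {a y : G} (ha : a ∈ l) (hy : y ∈ K) :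
    ⁅a, y⁆ ∈ (l.map fun a => (fun y : G => ⁅a, y⁆) '' (K : Set G)).prod := by
  induction l with
  | nil => simp at ha
  | cons b l ih =>
    rw [List.map_cons, List.prod_cons]
    rcases List.mem_cons.mp ha with rfl | ha'
    · exact Set.mem_mul.mpr ⟨⁅a, y⁆, ⟨y, hy, rfl⟩, 1, one_mem_wordSet l K, mul_one _⟩
    · exact Set.mem_mul.mpr ⟨1, ⟨1, K.one_mem, commutatorElement_one_right b⟩, ⁅a, y⁆, ih ha',
        one_mul _⟩

/-- `T(l, K) ⊆ Q` whenever `K ≤ Q` and `Q` is normal. [cite: DDMSAnalyticProP1999, Prop 1.19 (proof)] -/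
theorem wordSet_subset_of_le (l : List G) {K Q : Subgroup G} [hQ : Q.Normal] (hK : K ≤ Q) :
    (l.map fun a => (fun y : G => ⁅a, y⁆) '' (K : Set G)).prod ⊆ (Q : Set G) := by
  induction l with
  | nil => simp
  | cons a l ih =>
    rw [List.map_cons, List.prod_cons]
    rintro _ ⟨_, ⟨y, hy, rfl⟩, w, hw, rfl⟩
    refine Q.mul_mem ?_ (ih hw)
    show ⁅a, y⁆ ∈ Q
    rw [commutatorElement_def]
    exact Q.mul_mem (hQ.conj_mem y (hK hy) a) (Q.inv_mem (hK hy))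

/-- `T(l, K) ⊆ ⁅U, K⁆` whenever the entries of `l` lie in `U`.
[cite: DDMSAnalyticProP1999, Prop 1.19 (proof)] -/
theorem wordSet_subset_commutator (l : List G) (U K : Subgroup G) (hl : ∀ a ∈ l, a ∈ U) :
    (l.map fun a => (fun y : G => ⁅a, y⁆) '' (K : Set G)).prod ⊆ ((⁅U, K⁆ : Subgroup G) : Set G) := by
  induction l with
  | nil => simp
  | cons a l ih =>
    rw [List.map_cons, List.prod_cons]
    rintro _ ⟨_, ⟨y, hy, rfl⟩, w, hw, rfl⟩
    exact mul_mem (Subgroup.commutator_mem_commutator (hl a List.mem_cons_self) hy)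
      (ih (fun b hb => hl b (List.mem_cons_of_mem a hb)) hw)

/-- A homomorphism maps `T(l, K)` onto `T(f(l), f(K))`. [cite: DDMSAnalyticProP1999, Prop 1.19 (proof)] -/
theorem image_wordSet {H : Type*} [Group H] (f : G →* H) (l : List G) (K : Set G) :
    f '' (l.map fun a => (fun y : G => ⁅a, y⁆) '' K).prod =
      ((l.map f).map fun b => (fun z : H => ⁅b, z⁆) '' (f '' K)).prod := by
  induction l with
  | nil => simp [Set.singleton_one]
  | cons a l ih =>
    rw [List.map_cons, List.prod_cons, List.map_cons, List.map_cons, List.prod_cons, Set.image_mul,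
      ih]
    congr 1
    ext z
    simp only [Set.mem_image]
    constructor
    · rintro ⟨_, ⟨y, hy, rfl⟩, rfl⟩
      exact ⟨f y, ⟨y, hy, rfl⟩, (map_commutatorElement f a y).symm⟩
    · rintro ⟨_, ⟨y, hy, rfl⟩, rfl⟩
      exact ⟨⁅a, y⁆, ⟨y, hy, rfl⟩, map_commutatorElement f a y⟩

/-- `T(l, K) ⊆ C` as soon as `⁅a, k⁆ ∈ C` for all entries `a` of `l` and all `k ∈ K`.
[cite: DDMSAnalyticProP1999, Prop 1.19 (proof)] -/
theorem wordSet_subset_of_forall_mem (l : List G) {K : Set G} {C : Subgroup G}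
    (hC : ∀ a ∈ l, ∀ k ∈ K, ⁅a, k⁆ ∈ C) :
    (l.map fun a => (fun y : G => ⁅a, y⁆) '' K).prod ⊆ (C : Set G) := by
  induction l with
  | nil => simp
  | cons a l ih =>
    rw [List.map_cons, List.prod_cons]
    rintro _ ⟨_, ⟨y, hy, rfl⟩, w, hw, rfl⟩
    exact C.mul_mem (hC a List.mem_cons_self y hy)
      (ih (fun b hb k hk => hC b (List.mem_cons_of_mem a hb) k hk) hw)

/-- `T(l, K) ⊆ T(l, K')` for `K ⊆ K'`. [cite: DDMSAnalyticProP1999, Prop 1.19 (proof)] -/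
theorem wordSet_mono (l : List G) {K K' : Set G} (h : K ⊆ K') :
    (l.map fun a => (fun y : G => ⁅a, y⁆) '' K).prod ⊆
      (l.map fun a => (fun y : G => ⁅a, y⁆) '' K').prod := by
  induction l with
  | nil => simp
  | cons a l ih =>
    rw [List.map_cons, List.prod_cons, List.map_cons, List.prod_cons]
    exact Set.mul_subset_mul (Set.image_mono h) ih

/-! ### Computing modulo a normal subgroup `N` below which `C` is central in `Q`

Throughout, `C` is a subgroup with `⁅C, Q⁆ ≤ N` (so `C` is central in `Q` modulo `N`) containing the
commutators `⁅a, k⁆` under consideration. -/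

section Modulo

variable (N : Subgroup G) [hN : N.Normal] (Q : Subgroup G)

/-- If `⁅C, Q⁆ ≤ N` then the classes of `k ∈ C` and `g ∈ Q` commute in `G ⧸ N`.
[cite: DDMSAnalyticProP1999, Prop 1.19 (proof)] -/
theorem mk_mul_mk_comm_of_commutator_le {C : Subgroup G} (hCN : ⁅C, Q⁆ ≤ N) {k g : G} (hk : k ∈ C)
    (hg : g ∈ Q) :
    (QuotientGroup.mk g : G ⧸ N) * QuotientGroup.mk k = QuotientGroup.mk k * QuotientGroup.mk g := by
  rw [← QuotientGroup.mk_mul, ← QuotientGroup.mk_mul, QuotientGroup.eq]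
  have : (g * k)⁻¹ * (k * g) = ⁅k⁻¹, g⁻¹⁆ := by
    simp only [commutatorElement_def, mul_inv_rev, inv_inv, mul_assoc]
  rw [this]
  exact hCN (Subgroup.commutator_mem_commutator (inv_mem hk) (inv_mem hg))

/-- Conjugation by `g ∈ Q` is trivial on `C` modulo `N` when `⁅C, Q⁆ ≤ N`.
[cite: DDMSAnalyticProP1999, Prop 1.19 (proof)] -/
theorem mk_conj_eq_of_commutator_le {C : Subgroup G} (hCN : ⁅C, Q⁆ ≤ N) {k g : G} (hk : k ∈ C)
    (hg : g ∈ Q) : (QuotientGroup.mk (g * k * g⁻¹) : G ⧸ N) = QuotientGroup.mk k := by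
  rw [QuotientGroup.mk_mul, QuotientGroup.mk_mul, mk_mul_mk_comm_of_commutator_le N Q hCN hk hg,
    QuotientGroup.mk_inv, mul_inv_cancel_right]

/-- Elements of `T(l, K)` commute with `Q` modulo `N` when all `⁅a, k⁆` lie in `C`, `⁅C, Q⁆ ≤ N`.
[cite: DDMSAnalyticProP1999, Prop 1.19 (proof)] -/
theorem mk_mul_mk_comm_of_mem_wordSet {K : Set G} {C : Subgroup G} (hCN : ⁅C, Q⁆ ≤ N)
    {l : List G} (hC : ∀ a ∈ l, ∀ k ∈ K, ⁅a, k⁆ ∈ C) {t g : G}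
    (ht : t ∈ (l.map fun a => (fun y : G => ⁅a, y⁆) '' K).prod) (hg : g ∈ Q) :
    (QuotientGroup.mk g : G ⧸ N) * QuotientGroup.mk t = QuotientGroup.mk t * QuotientGroup.mk g :=
  mk_mul_mk_comm_of_commutator_le N Q hCN (wordSet_subset_of_forall_mem l hC ht) hg

/-- For `x ∈ Q` and `⁅a, k⁆ ∈ C` (`⁅C, Q⁆ ≤ N`): `⁅a, x·k⁆ ≡ ⁅a, x⁆ · ⁅a, k⁆ (mod N)`.
[cite: DDMSAnalyticProP1999, Prop 1.19 (proof)] -/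
theorem mk_comm_mul_right_of_commutator_le {C : Subgroup G} (hCN : ⁅C, Q⁆ ≤ N) (a : G) {x k : G}
    (hx : x ∈ Q) (hak : ⁅a, k⁆ ∈ C) :
    (QuotientGroup.mk ⁅a, x * k⁆ : G ⧸ N) = QuotientGroup.mk ⁅a, x⁆ * QuotientGroup.mk ⁅a, k⁆ := by
  rw [commutatorElement_mul_right_eq, QuotientGroup.mk_mul,
    mk_conj_eq_of_commutator_le N Q hCN hak hx]

/-- For `k ∈ Q` with `⁅a, k⁻¹⁆ ∈ C` (`⁅C, Q⁆ ≤ N`): `⁅a, k⁻¹⁆ ≡ ⁅a, k⁆⁻¹ (mod N)`.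
[cite: DDMSAnalyticProP1999, Prop 1.19 (proof)] -/
theorem mk_comm_inv_right_of_commutator_le {C : Subgroup G} (hCN : ⁅C, Q⁆ ≤ N) (a : G) {k : G}
    (hk : k ∈ Q) (hak : ⁅a, k⁻¹⁆ ∈ C) :
    (QuotientGroup.mk ⁅a, k⁻¹⁆ : G ⧸ N) = (QuotientGroup.mk ⁅a, k⁆)⁻¹ := by
  refine eq_inv_of_mul_eq_one_right ?_
  rw [← mk_comm_mul_right_of_commutator_le N Q hCN a hk hak, mul_inv_cancel,
    commutatorElement_one_right, QuotientGroup.mk_one]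

/-- MERGE: for `u ∈ T(l, K')` and `v ∈ T(l, K)` with `K ≤ K' ≤ Q`, `Q` normal, all `⁅a, k⁆ ∈ C`
(`a` in `l`, `k ∈ K`) and `⁅C, Q⁆ ≤ N`: `u · v ≡ w (mod N)` for some `w ∈ T(l, K')` (merge
`⁅aᵢ, xᵢ⁆ ⁅aᵢ, kᵢ⁆ ≡ ⁅aᵢ, xᵢkᵢ⁆`, the `⁅aᵢ, kᵢ⁆` being central). [cite: DDMSAnalyticProP1999, Prop 1.19 (proof)] -/
theorem exists_mk_mul_mk_eq_of_mem_wordSet [hQ : Q.Normal] {K K' C : Subgroup G}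
    (hCN : ⁅C, Q⁆ ≤ N) {l : List G} (hC : ∀ a ∈ l, ∀ k ∈ K, ⁅a, k⁆ ∈ C)
    (hKK' : K ≤ K') (hK'Q : K' ≤ Q) {u v : G}
    (hu : u ∈ (l.map fun a => (fun y : G => ⁅a, y⁆) '' (K' : Set G)).prod)
    (hv : v ∈ (l.map fun a => (fun y : G => ⁅a, y⁆) '' (K : Set G)).prod) :
    ∃ w ∈ (l.map fun a => (fun y : G => ⁅a, y⁆) '' (K' : Set G)).prod,
      (QuotientGroup.mk u : G ⧸ N) * QuotientGroup.mk v = QuotientGroup.mk w := by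
  induction l generalizing u v with
  | nil =>
    simp only [List.map_nil, List.prod_nil, Set.mem_one] at hu hv ⊢
    exact ⟨1, rfl, by rw [hu, hv, QuotientGroup.mk_one, one_mul]⟩
  | cons a l ih =>
    rw [List.map_cons, List.prod_cons] at hu hv ⊢
    obtain ⟨_, ⟨x, hx, rfl⟩, u', hu', rfl⟩ := Set.mem_mul.mp hu
    obtain ⟨_, ⟨k, hk, rfl⟩, v', hv', rfl⟩ := Set.mem_mul.mp hv
    have hC' : ∀ b ∈ l, ∀ k ∈ (K : Set G), ⁅b, k⁆ ∈ C :=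
      fun b hb k hk => hC b (List.mem_cons_of_mem a hb) k hk
    obtain ⟨w', hw', hw'eq⟩ := ih hC' hu' hv'
    refine ⟨⁅a, x * k⁆ * w', Set.mem_mul.mpr ⟨⁅a, x * k⁆, ⟨x * k, mul_mem hx (hKK' hk), rfl⟩, w',
      hw', rfl⟩, ?_⟩
    have hu'Q : u' ∈ Q := wordSet_subset_of_le l hK'Q hu'
    have hak : ⁅a, k⁆ ∈ C := hC a List.mem_cons_self k hk
    rw [QuotientGroup.mk_mul, QuotientGroup.mk_mul, QuotientGroup.mk_mul,
      mk_comm_mul_right_of_commutator_le N Q hCN a (hK'Q hx) hak, ← hw'eq, mul_assoc, mul_assoc,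
      ← mul_assoc (QuotientGroup.mk u'), mk_mul_mk_comm_of_commutator_le N Q hCN hak hu'Q, mul_assoc]

/-- INVERSE: for `v ∈ T(l, K)` (`K ≤ Q`, all `⁅a, k⁆ ∈ C`, `⁅C, Q⁆ ≤ N`), `v⁻¹ ≡ w (mod N)` for
some `w ∈ T(l, K)`. [cite: DDMSAnalyticProP1999, Prop 1.19 (proof)] -/
theorem exists_mk_inv_eq_of_mem_wordSet [hQ : Q.Normal] {K C : Subgroup G} (hCN : ⁅C, Q⁆ ≤ N)
    {l : List G} (hC : ∀ a ∈ l, ∀ k ∈ K, ⁅a, k⁆ ∈ C) (hKQ : K ≤ Q) {v : G}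
    (hv : v ∈ (l.map fun a => (fun y : G => ⁅a, y⁆) '' (K : Set G)).prod) :
    ∃ w ∈ (l.map fun a => (fun y : G => ⁅a, y⁆) '' (K : Set G)).prod,
      (QuotientGroup.mk v : G ⧸ N)⁻¹ = QuotientGroup.mk w := by
  induction l generalizing v with
  | nil =>
    simp only [List.map_nil, List.prod_nil, Set.mem_one] at hv ⊢
    exact ⟨1, rfl, by rw [hv, QuotientGroup.mk_one, inv_one]⟩
  | cons a l ih =>
    rw [List.map_cons, List.prod_cons] at hv ⊢
    obtain ⟨_, ⟨k, hk, rfl⟩, v', hv', rfl⟩ := Set.mem_mul.mp hv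
    have hC' : ∀ b ∈ l, ∀ k ∈ (K : Set G), ⁅b, k⁆ ∈ C :=
      fun b hb k hk => hC b (List.mem_cons_of_mem a hb) k hk
    obtain ⟨w', hw', hw'eq⟩ := ih hC' hv'
    refine ⟨⁅a, k⁻¹⁆ * w', Set.mem_mul.mpr ⟨⁅a, k⁻¹⁆, ⟨k⁻¹, inv_mem hk, rfl⟩, w', hw', rfl⟩, ?_⟩
    have hak : ⁅a, k⁻¹⁆ ∈ C := hC a List.mem_cons_self k⁻¹ (inv_mem hk)
    rw [QuotientGroup.mk_mul, QuotientGroup.mk_mul, mul_inv_rev, hw'eq,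
      ← mk_comm_inv_right_of_commutator_le N Q hCN a (hKQ hk) hak]
    exact mk_mul_mk_comm_of_commutator_le N Q hCN hak (wordSet_subset_of_le l hKQ hw')

end Modulo

end Literature.GroupTheory
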